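import Literature.NumberTheory.LFunctions.Zhang2022.KnifeEdgeEllVernierClear
import Literature.NumberTheory.LFunctions.Zhang2022.ObjectiveTwinDetAfeK13

/-!
# §D edge ell — card `ell-vernier-far-pair`: the far pair in GRID/INTEGRAND units (the author's booked D1 in the
# `F ≡ 1` scenario = `Det.shiftRecipe` at the offset triple), the straddling dichotomy, and the packet's one-line glue

Y. Zhang, *Discrete mean estimates and the Landau–Siegel zero*, arXiv:2211.02515v1 [Zhang2022LandauSiegel] — an
unrefereed manuscript under adjudication. **WHAT THIS IS NOT: not a claim about Theorems 1–2 of arXiv:2211.02515,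
about Landau–Siegel zeros, about Parity, or about a repaired `Margin232`; the bare `Prop`s below (`VernierGridPSD`,
`VernierGridDichotomy`) are DEFINITIONS asserted by no one. The programme SEARCHES and TYPES; no claim about
Landau–Siegel zeros, Theorems 1–2 of arXiv:2211.02515 or a repaired Margin232 until a kernel theorem says so.**
(LANDAU–SIEGEL programme F-S3, cell `landau-siegel`, §D edge ell; typer ls-knife-typer-2 g3; companion of
`KnifeEdgeEllVernier{,Endgame,Positivity,Clear}.lean`.)

## Contents
* Part A — the referee's grid-unit triple `vernierShiftsOff b₀ J m θ = (b₀; J+m−θ, J+1−m−θ)` (ls-ref-1 g2, cell STATUS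
  2026-08-27T00:34:41Z «the unit-consistent object»; `vernierShiftsOff_zero = vernierShifts`), the **straddling
  dichotomy** `signAdmissible_vernierShiftsOff_iff` (in Lemma 2.3's sign box iff `θ ≤ m ∨ 1 − m ≤ θ`, for `0 < b₀ ≤ 1`,
  `0 < m < ½`, `0 ≤ θ < 1`, `J ≥ 2`), `not_signAdmissible_vernierShiftsOff`, `vernierShiftsOff_edge`
  (`(1; 3, 0, ½) ↦ (1, 5/2, 7/2)`) and `not_formDetPSD_vernierShiftsOff_edge` (obj-eng-3's exact twin
  `Det.not_formDetPSD_shiftRecipe_edge52`, value `−46π/45 − 112/27` on `k₁ − k₃`, read in vernier coordinates).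
* Part B — the packet's glue with the manuscript's constant `c′` eliminated: `theorem1_of_vernier_eventual` (shape S1:
  `∃ c₁ ∀ c′ ≥ c₁, VernierDict …` + `m < 0` + `VernierBracketClearAll θ` ⇒ `Theorem1`) and
  `theorem1_of_vernierClear_eventual` (shape S2: `∃ c₁ ∀ c′ ≥ c₁, VernierClearDict …` + `μ < 0` ⇒ `Theorem1`).
* Part C — **D1 in integrand units** (author ls-knife-ell-idea-2 g2, cell INBOX 2026-08-27T01:29:20Z (i)): with all
  mismatch phases booked the vernier recipe «COLLAPSES to `Det.shiftRecipe` at the REAL far positions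
  (1⁻; J+m−θ_I, J+1−m−θ_I), θ_I = (J+½)ε, ε = 1 − log P/L_Δ(p)», dressed by χ-form-factors (`F ≡ 1` generic under (A)):
  `integrandOffset` (ε), `thetaI` (θ_I), `vernierGridRecipe b₀ J m θ := Det.shiftRecipe (vernierShiftsOff b₀ J m θ)`,
  `vernierGridForm` (its `Det.FormDet`), `vernierGridRecipe_zero` (= the θ-blind control `vernierRecipe`), the E*-S slot
  `VernierGridPSD`, the author's falsifier reading (ii) «INDEFINITE ⟺ θ mod 1 ∈ (m, 1−m)» as the OPEN per-cell statement
  `VernierGridDichotomy J m` (⟺ «PSD iff sign-admissible», `vernierGridDichotomy_iff_signAdmissible`), and the kernel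
  instance of its negative side `not_vernierGridPSD_edge`.
NOT here: the dressed form (χ-form-factors `F, G`), the value table of K3 and the constant of K1 — they wait on the
author's memo VERNIER-FORMULA-I.md (desk 00:49:01Z: K3's table and constant must be NAMED defs).
References: Zhang, arXiv:2211.02515v1, §2 (2.6), (2.10), (2.13), Lemma 2.3; §7 Prop 7.1, (7.19)–(7.21)
[cite: Zhang2022LandauSiegel, §2 Lemma 2.3; §7 Prop 7.1].
-/

noncomputable section

open Complex Real Set
open scoped ComplexConjugate

namespace Literature.NumberTheory.LFunctions.Zhang2022.KnifeEdgeEll.Vernier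

open Literature.NumberTheory.LFunctions.Zhang2022 Skeleton

/-! ## Part A — the far pair in GRID units: the straddling dichotomy and the edge (referee ls-ref-1 g2's object) -/

/-- **The vernier triple in GRID units with the accumulated offset booked on the far pair** (referee ls-ref-1 g2,
cell STATUS 2026-08-27T00:34:41Z, «the unit-consistent object»; critic's probe (E)): `(b₀; J + m − θ, J + 1 − m − θ)` —
the far pair displaced by the root-versus-grid offset `θ` it sits at. At `θ = 0` this is `vernierShifts b₀ J m`.
[cite: Zhang2022LandauSiegel, §2 (2.13), Lemma 2.3] -/
def vernierShiftsOff (b₀ : ℝ) (J : ℕ) (m θ : ℝ) : Fin 3 → ℝ := ![b₀, (J : ℝ) + m - θ, (J : ℝ) + 1 - m - θ]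

/-- No offset: the grid-unit triple is the fence-unit triple. [cite: Zhang2022LandauSiegel, §2 (2.13)] -/
theorem vernierShiftsOff_zero (b₀ : ℝ) (J : ℕ) (m : ℝ) : vernierShiftsOff b₀ J m 0 = vernierShifts b₀ J m := by
  funext j; fin_cases j <;> simp [vernierShiftsOff, vernierShifts]

/-- **The straddling dichotomy (kernel form of the referee's «negative iff straddling» reading's admissibility side):**
for `0 < b₀ ≤ 1`, `0 < m < 1/2`, `0 ≤ θ < 1` and `J ≥ 2`, the offset triple is in Lemma 2.3's sign box
`Det.SignAdmissible` IFF the displaced far pair does not straddle the grid integer `J`, i.e. iff `θ ≤ m` or `1 − m ≤ θ`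
(witness gap `k = J`, resp. `k = J − 1`). [cite: Zhang2022LandauSiegel, §2 (2.13), Lemma 2.3 and its proof p.12] -/
theorem signAdmissible_vernierShiftsOff_iff {b₀ m θ : ℝ} {J : ℕ} (hb₀ : 0 < b₀) (hb₀' : b₀ ≤ 1) (hm : 0 < m)
    (hm' : m < 1 / 2) (hθ : 0 ≤ θ) (hθ' : θ < 1) (hJ : 2 ≤ J) :
    Det.SignAdmissible (vernierShiftsOff b₀ J m θ) ↔ (θ ≤ m ∨ 1 - m ≤ θ) := by
  have hJr : (2 : ℝ) ≤ (J : ℝ) := by exact_mod_cast hJ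
  constructor
  · rintro ⟨-, -, -, -, k, hk1, hk2⟩
    simp only [vernierShiftsOff, Matrix.cons_val_one, Matrix.cons_val] at hk1 hk2
    by_contra h
    push Not at h
    obtain ⟨h1, h2⟩ := h
    -- then k ≤ J + m − θ < J and J < J + 1 − m − θ ≤ k + 1, so J − 1 < k < J: no integer
    have hk_lt : (k : ℝ) < J := by linarith
    have hk_gt : (J : ℝ) < k + 1 := by linarith
    have h3 : k < J := by exact_mod_cast hk_lt
    have h4 : J < k + 1 := by exact_mod_cast hk_gt
    omega
  · intro h
    refine ⟨by simp [vernierShiftsOff]; linarith, by simp [vernierShiftsOff]; linarith,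
      by simp [vernierShiftsOff]; linarith, by simp [vernierShiftsOff]; linarith, ?_⟩
    rcases h with h | h
    · refine ⟨J, ?_, ?_⟩ <;> simp [vernierShiftsOff] <;> linarith
    · refine ⟨J - 1, ?_, ?_⟩
      · have : ((J - 1 : ℕ) : ℝ) = (J : ℝ) - 1 := by
          rw [Nat.cast_sub (by omega)]; simp
        simp [vernierShiftsOff, this]; linarith
      · have : ((J - 1 : ℕ) : ℝ) = (J : ℝ) - 1 := by
          rw [Nat.cast_sub (by omega)]; simp
        simp [vernierShiftsOff, this]; linarith

/-- Every offset triple whose far pair straddles (`m < θ < 1 − m`) is OUTSIDE the sign box.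
[cite: Zhang2022LandauSiegel, §2 (2.13), Lemma 2.3] -/
theorem not_signAdmissible_vernierShiftsOff {b₀ m θ : ℝ} {J : ℕ} (hb₀ : 0 < b₀) (hb₀' : b₀ ≤ 1) (hm : 0 < m)
    (hm' : m < 1 / 2) (hJ : 2 ≤ J) (h1 : m < θ) (h2 : θ < 1 - m) :
    ¬ Det.SignAdmissible (vernierShiftsOff b₀ J m θ) := by
  rw [signAdmissible_vernierShiftsOff_iff hb₀ hb₀' hm hm' (by linarith) (by linarith) hJ]
  push Not
  exact ⟨h1, h2⟩


/-- The referee's edge triple IS the offset triple at `J = 3`, zero margin, offset `θ = 1/2` (the `m → 0` corner of the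
straddling family at half offset). [cite: Zhang2022LandauSiegel, §2 (2.13)] -/
theorem vernierShiftsOff_edge : vernierShiftsOff 1 3 0 (1 / 2) = ![1, 5 / 2, 7 / 2] := by
  funext j; fin_cases j <;> simp [vernierShiftsOff] <;> norm_num

/-- **The θ-blind far-pair recipe at the straddling edge is NOT PSD (kernel):** `¬ Det.FormDetPSD (Det.shiftRecipe
(vernierShiftsOff 1 3 0 (1/2)))` — obj-eng-3's exact twin `Det.not_formDetPSD_shiftRecipe_edge52` of the referee's
witness (`FormDet (shiftRecipe (1,5/2,7/2)) (k₁ − k₃) = −46π/45 − 112/27`, `ObjectiveTwinDetAfeK13`) read in the vernier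
coordinates. The card's θ-blind CONTROL members `vernierRecipe b₀ J m` (`0 < m < 1/2`, offset `0`) are inside the sign
box (`vernier_signAdmissible`); this says nothing about them. [cite: Zhang2022LandauSiegel, Prop 7.1 p.44, (7.2); §2 Lemma 2.3] -/
theorem not_formDetPSD_vernierShiftsOff_edge :
    ¬ Det.FormDetPSD (Det.shiftRecipe (vernierShiftsOff 1 3 0 (1 / 2))) := by
  rw [vernierShiftsOff_edge]
  exact Det.not_formDetPSD_shiftRecipe_edge52


/-! ## Part B — the packet's glue with the manuscript's constant `c′` eliminated («for all sufficiently large c′») -/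

/-- **Glue S1 (card's margin), `c′` eliminated:** if the vernier dictionary on the coherent sub-family holds for all
sufficiently large `c′` with a NEGATIVE constant, and the far bracket is clear at every coherent pair, then Theorem 1.
[cite: Zhang2022LandauSiegel, §1 Theorem 1; §2 Lemma 2.3, Prop. 2.2] -/
theorem theorem1_of_vernier_eventual {θ m : ℝ} {F : ValueTable} (hθ : 0 ≤ θ)
    (hK3 : ∃ c₁ : ℝ, ∀ c' : ℝ, c₁ ≤ c' → VernierDict θ c' coherentFam F m) (hK1 : m < 0)
    (hB : VernierBracketClearAll θ) : Theorem1 := by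
  obtain ⟨c₀, -, h⟩ := theorem1_of_vernier_bracketClear_closed hθ
  obtain ⟨c₁, h1⟩ := hK3
  exact h (max c₀ c₁) (le_max_left _ _) (h1 _ (le_max_right _ _)) hK1 hB

/-- **Glue S2 (restricted detector, fixed margin), `c′` eliminated:** dictionary for the restricted mean for all large
`c′` with NEGATIVE constant ⇒ Theorem 1 (`0 ≤ θ`, `0 < m ≤ ½`). [cite: Zhang2022LandauSiegel, §1 Theorem 1; §2 Lemma 2.3, Prop. 2.2] -/
theorem theorem1_of_vernierClear_eventual {θ m μ : ℝ} {F : ValueTable} (hθ : 0 ≤ θ) (hm : 0 < m) (hm' : m ≤ 1 / 2)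
    (hK3 : ∃ c₁ : ℝ, ∀ c' : ℝ, c₁ ≤ c' → VernierClearDict θ m c' F μ) (hK1 : μ < 0) : Theorem1 := by
  obtain ⟨c₀, -, h⟩ := theorem1_of_vernierClearDict_closed (θ := θ) hθ hm hm'
  obtain ⟨c₁, h1⟩ := hK3
  exact h (max c₀ c₁) (le_max_left _ _) (h1 _ (le_max_right _ _)) hK1

/-! ## Part C — D1 in INTEGRAND units (author ls-knife-ell-idea-2 g2, cell INBOX 2026-08-27T01:29:20Z (i)–(ii)):
«with ALL mismatch phases booked ((pt₀)^{Σβ/2} prefactor, p^{−β_j}, α̃ vs α) the vernier recipe in INTEGRAND units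
(y = log n/log P) COLLAPSES to `Det.shiftRecipe` at REAL far positions b^{int} = (1⁻; J+m−θ_I, J+1−m−θ_I),
θ_I = (J+½)ε, ε = 1 − log P/L_Δ(p)», dressed by χ-form-factors `F, G` («F ≡ G ≡ 1 iff the non-square λ-mass below
D^{1+o(1)} is o(1) — allowed and generic under (A), not forced»). Typed here in the `F ≡ 1` scenario = the author's
falsifier object; the dressed form and the value table of K3 wait on the memo VERNIER-FORMULA-I.md. -/

/-- **The integrand-unit offset per gap `ε(p) = 1 − log P/L_Δ(p)`** (`= (log(p/P) + ½𝓛 + 519 log 𝓛)/L_Δ(p)` at the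
printed scales; author 01:29:20Z (i)). [cite: Zhang2022LandauSiegel, §2 (2.6), (2.10)] -/
def integrandOffset (D : ℕ) (p : ℝ) : ℝ :=
  1 - (EllScales.Scales.pinned D).logP / (EllScales.Scales.pinned D).LDelta p

/-- **The accumulated integrand-unit offset of the far pair `θ_I = (J + ½)·ε(p)`** (author: `θ_I = θ(1 + O(log 𝓛/𝓛))`).
[cite: Zhang2022LandauSiegel, §2 (2.6), (2.10), (2.13)] -/
def thetaI (θ : ℝ) (D : ℕ) (p : ℝ) : ℝ := ((vernierJAt θ D p : ℝ) + 1 / 2) * integrandOffset D p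

/-- **D1 in integrand units, `F ≡ 1` scenario: the booked vernier recipe IS the shift recipe at the offset triple**
`(b₀; J+m−θ, J+1−m−θ)` (author 01:29:20Z (i); `Det.shiftRecipe`, weights `Det.shiftW` — in-house, registry E-010).
[cite: Zhang2022LandauSiegel, Prop 7.1, (7.19)–(7.21); §2 (2.13)] -/
def vernierGridRecipe (b₀ : ℝ) (J : ℕ) (m θ : ℝ) : Det.DetRecipe := Det.shiftRecipe (vernierShiftsOff b₀ J m θ)

/-- **The booked vernier main-term form in the `F ≡ 1` scenario:** `𝔅^V_{b₀,J,m,θ}(G) = Det.FormDet (vernierGridRecipe b₀ J m θ) G G′`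
— the card's D1 up to the χ-form-factor dressing the memo supplies. CAVEAT OF RECORD (critic ls-knife-crit-2 g3
2026-08-27T01:39:19Z (i)–(ii), author 01:42:12Z): the TYPED DETECTOR's near shift `β₁ = iα(1 − 5c′α𝓛)` has grid
coordinate `b₀ = 1 − κ/J`, `κ = 10πc′θ > 0` — NOT `b₀ = 1`; its idealised main term is the member `b₀ = 1 − κ/J`
(`VernierDetectorCellPSD`, certified PSD), the members at `b₀ = 1` are the EDGE form. [cite: Zhang2022LandauSiegel, Prop 7.1 p.44, (7.2)] -/
def vernierGridForm (b₀ : ℝ) (J : ℕ) (m θ : ℝ) (G G' : ℝ → ℂ) : ℝ := Det.FormDet (vernierGridRecipe b₀ J m θ) G G'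

/-- At zero offset the booked recipe is the card's θ-blind control recipe `vernierRecipe` (p475215).
[cite: Zhang2022LandauSiegel, Prop 7.1, (7.19)–(7.21)] -/
theorem vernierGridRecipe_zero (b₀ : ℝ) (J : ℕ) (m : ℝ) : vernierGridRecipe b₀ J m 0 = vernierRecipe b₀ J m := by
  rw [vernierGridRecipe, vernierShiftsOff_zero]; rfl

/-- **E*-S slot of the booked recipe (OPEN shape):** `Det.FormDetPSD (vernierGridRecipe b₀ J m θ)`.
[cite: Zhang2022LandauSiegel, Prop 7.1 p.44, (7.2)] -/
def VernierGridPSD (b₀ : ℝ) (J : ℕ) (m θ : ℝ) : Prop := Det.FormDetPSD (vernierGridRecipe b₀ J m θ)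

/-- **EDGE FORM — near shift at `b₀ = 1` grid units, which is NOT the typed detector's `β₁` (`b₀ = 1 − κ/J`); no glue
of the vernier layer consumes this statement, and it does NOT settle K1 for the detector as typed (critic 01:39:19Z (ii),
author 01:42:12Z (c)). The author's falsifier READING as a statement (OPEN — certified-float evidence only, 01:29:20Z (ii)):**
«booked form INDEFINITE ⟺ θ mod 1 ∈ (m, 1−m) ⟺ the integer J lies strictly inside the integrand-unit far pair», i.e.
at the near edge `b₀ = 1`, for `θ ∈ [0,1)`: PSD iff `θ ≤ m ∨ 1 − m ≤ θ` — by `signAdmissible_vernierShiftsOff_iff` this is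
«PSD ⟺ the offset triple is in Lemma 2.3's sign box» (the K15c pattern of `Det.signAdmissible_ellRecipe_iff` /
`Det.not_formDetPSD_ellRecipe`, now for far pairs). A bare `Prop` per cell `(J, m)`; one kernel instance of the
negative side is `not_vernierGridPSD_edge`. [cite: Zhang2022LandauSiegel, Prop 7.1 p.44, (7.2); §2 Lemma 2.3] -/
def VernierGridDichotomy (J : ℕ) (m : ℝ) : Prop :=
  ∀ θ : ℝ, 0 ≤ θ → θ < 1 → (VernierGridPSD 1 J m θ ↔ (θ ≤ m ∨ 1 - m ≤ θ))

/-- The dichotomy's right side IS sign-admissibility of the offset triple (`0 < m < 1/2`, `J ≥ 2`).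
[cite: Zhang2022LandauSiegel, §2 Lemma 2.3, (2.13)] -/
theorem vernierGridDichotomy_iff_signAdmissible {J : ℕ} {m : ℝ} (hm : 0 < m) (hm' : m < 1 / 2) (hJ : 2 ≤ J) :
    VernierGridDichotomy J m ↔
      ∀ θ : ℝ, 0 ≤ θ → θ < 1 → (VernierGridPSD 1 J m θ ↔ Det.SignAdmissible (vernierShiftsOff 1 J m θ)) := by
  refine forall_congr' fun θ => forall_congr' fun hθ => forall_congr' fun hθ' => ?_
  rw [signAdmissible_vernierShiftsOff_iff one_pos le_rfl hm hm' hθ hθ' hJ]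

/-- **Kernel instance of the negative side at the EDGE** `(b₀, J, m, θ) = (1, 3, 0, ½)`: the booked recipe is the
referee's `shiftRecipe (1, 5/2, 7/2)`, NOT PSD (obj-eng-3's exact twin, value `−46π/45 − 112/27` on `k₁ − k₃`). EDGE form:
near shift ON the model zero `b = 1`, not the typed detector's `β₁` — the negativity lives in the near-INADMISSIBLE sliver
`1 − b₀ < w(m)/J²` (certified crossover, kits j264630 / j264695), not at `b₀ = 1 − κ/J`. [cite: Zhang2022LandauSiegel, Prop 7.1 p.44, (7.2)] -/
theorem not_vernierGridPSD_edge : ¬ VernierGridPSD 1 3 0 (1 / 2) := not_formDetPSD_vernierShiftsOff_edge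


/-! ## Part D — the CONSISTENT booking (critic of record ls-knife-crit-2 g3, 2026-08-27T01:32:23Z (1)/(3), R1): all
three shifts fence-booked, `x = (1−ε)·(1, J+m, J+1−m)` in integrand units — the near shift scaled with the far pair
(near-admissibility: `β₁` under `γ⁺` for every `ρ` forces `x₀ ≤ 1 − ε`). The referee / custodian certify this member
PSD on the whole one-sided class cell by cell (num-1 j264045 (E) 56/56, incl. straddlers); the statement below is the
barrier-note SHAPE «every consistently booked, near-admissible vernier recipe is PSD» — OPEN, asserted by no one. -/

/-- **The consistently booked vernier triple** `c·(1, J+m, J+1−m)` (`c = 1 − ε(p)` at member `p`).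
[cite: Zhang2022LandauSiegel, §2 (2.13); Prop 7.1, (7.19)–(7.21)] -/
def vernierScaledShifts (c : ℝ) (J : ℕ) (m : ℝ) : Fin 3 → ℝ := fun j => c * vernierShifts 1 J m j

/-- At `c = 1` it is the θ-blind triple. [cite: Zhang2022LandauSiegel, §2 (2.13)] -/
theorem vernierScaledShifts_one (J : ℕ) (m : ℝ) : vernierScaledShifts 1 J m = vernierShifts 1 J m := by
  funext j; simp [vernierScaledShifts]

/-- The consistently booked recipe `Det.shiftRecipe (c·(1, J+m, J+1−m))`. [cite: Zhang2022LandauSiegel, Prop 7.1, (7.19)–(7.21)] -/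
def vernierScaledRecipe (c : ℝ) (J : ℕ) (m : ℝ) : Det.DetRecipe := Det.shiftRecipe (vernierScaledShifts c J m)

/-- Its E*-S slot (OPEN shape): `Det.FormDetPSD (vernierScaledRecipe c J m)` — certified TRUE cell by cell by the
custodian's whole-class criterion (kit j264045, 56/56, `c = 1 − θ/J`), including the cells whose scaled far pair straddles
the integer `J` (so, unlike the near edge `b₀ = 1`, «PSD iff sign-admissible» FAILS here: straddlers are PSD).
[cite: Zhang2022LandauSiegel, Prop 7.1 p.44, (7.2)] -/
def VernierScaledPSD (c : ℝ) (J : ℕ) (m : ℝ) : Prop := Det.FormDetPSD (vernierScaledRecipe c J m)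

/-- **Barrier-note shape per cell `(J, m)` (OPEN, asserted by no one): every consistently booked, near-admissible vernier
recipe is PSD** — `VernierScaledPSD c J m` for all scalings `c ∈ (0,1]`. If TRUE for the design's `(J, m)`, the card's K1
is dead in every unit-consistent booking with the near shift below the first fence zero (critics' sentence of
2026-08-27T01:28–01:32Z); the certified evidence is cell-wise, a kernel proof would come from the cell's E-010(ii) /
Parseval programme. [cite: Zhang2022LandauSiegel, Prop 7.1 p.44, (7.2); §2 Lemma 2.3] -/
def ConsistentVernierPSD (J : ℕ) (m : ℝ) : Prop :=
  ∀ c : ℝ, 0 < c → c ≤ 1 → VernierScaledPSD c J m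

/-- The printed recipe is the member `c = 1`, `(J, m) = (2, 0)` (triple `(1,2,3)`), whose slot is the theorem
`Det.formDetPSD_zhang` (via `vernierThetaBlindPSD_printed`).
[cite: Zhang2022LandauSiegel, Prop 7.1 with (8.11)–(8.23)] -/
theorem vernierScaledPSD_printed : VernierScaledPSD 1 2 0 := by
  unfold VernierScaledPSD vernierScaledRecipe
  rw [vernierScaledShifts_one]
  exact vernierThetaBlindPSD_printed

/-! ## Part E — the typed detector's own idealised main-term slot (critic of record 01:39:19Z (i)/(iii)): near
coordinate `b₀ = 1 − κ/J`, `κ = 10πc′θ`; VERDICT OF RECORD for the card's sign crux (author 01:42:12Z, critic 01:28–01:43Z,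
referee ls-ref-1 g2 kits j263358 / VERN3 j263953 / j264630 / j264695, custodian j264045): this slot is certified PSD on
every probed cell — K1 is numerically dead for the detector as typed; the card `ell-vernier-far-pair` is NOT-A-ROUTE for
its sign crux. Nothing below asserts that; the slot is a bare `Prop`. -/

/-- **The near detuning of the typed detector in grid units, times `J`:** `κ(c′, θ) = 10π·c′·θ` (from
`β₁ = iα(1 − 5c′α𝓛)`, `5c′α𝓛 = 5πc′/𝓛⁸ = κ/J` at `J = 2θ𝓛⁸`). [cite: Zhang2022LandauSiegel, §2 (2.13), (2.6), (2.10)] -/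
def kappaNear (c' θ : ℝ) : ℝ := 10 * π * c' * θ

/-- **K1 slot of the TYPED detector at cell `(J, m, θ)` (OPEN shape, critic's suggested slot 01:39:19Z (iii)):**
`Det.FormDetPSD` of the booked recipe with near coordinate `1 − κ(c′,θ)/J` and the far pair at offset `θ` — its NEGATION is
what a sign crux for the detector as typed would assert, and what the certified numerics refute cell by cell (VERN3
j263953: `x₀ = 1 − c/J`, `c ≥ 1/5`, `m ≥ 1/10` ⇒ 0/240 negative). [cite: Zhang2022LandauSiegel, Prop 7.1 p.44, (7.2); §2 (2.13)] -/
def VernierDetectorCellPSD (c' : ℝ) (J : ℕ) (m θ : ℝ) : Prop :=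
  VernierGridPSD (1 - kappaNear c' θ / J) J m θ

/-- Unfolding: the cell slot is the E*-S slot of `Det.shiftRecipe (1 − κ/J; J+m−θ, J+1−m−θ)`.
[cite: Zhang2022LandauSiegel, Prop 7.1 p.44, (7.2)] -/
theorem vernierDetectorCellPSD_iff (c' : ℝ) (J : ℕ) (m θ : ℝ) :
    VernierDetectorCellPSD c' J m θ ↔
      Det.FormDetPSD (Det.shiftRecipe (vernierShiftsOff (1 - kappaNear c' θ / J) J m θ)) := Iff.rfl

/-! ## Part F — the referee's EXACT-CONVERSION cells (ls-ref-1 g2, 2026-08-27T01:48:50Z «02:00Z close deferred ≤ 60 min;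
one corner certificate requested»): `b = (1 − θ/(J+½))·(1, J+m, J+1−m)` at micro-margins `m ∈ {10⁻², …, 10⁻⁵}` — the member
of the consistent-booking family at the exact conversion scale. Decision rule of record: all cells certified PSD ⇒ the card
closes «falsified»; any certified negative cell at `m > 0` ⇒ the card lives as «K1 | K3-far at micro-margins m ≍ θ/J». The
statements below NAME those cells; nothing is asserted. -/

/-- **The exact conversion scale** `c(θ, J) = 1 − θ/(J + ½)` (`= 1 − ε` with `θ_I = (J+½)ε = θ`).
[cite: Zhang2022LandauSiegel, §2 (2.6), (2.10), (2.13)] -/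
def exactConversionScale (θ : ℝ) (J : ℕ) : ℝ := 1 - θ / ((J : ℝ) + 1 / 2)

/-- **The referee's cell «VERNE0:J:m:θ» (OPEN shape):** `Det.FormDetPSD` of `Det.shiftRecipe ((1 − θ/(J+½))·(1, J+m, J+1−m))`
— `VernierScaledPSD` at the exact conversion scale. [cite: Zhang2022LandauSiegel, Prop 7.1 p.44, (7.2); §2 (2.13)] -/
def VernierExactCellPSD (θ : ℝ) (J : ℕ) (m : ℝ) : Prop := VernierScaledPSD (exactConversionScale θ J) J m

/-- Unfolding to the recipe level. [cite: Zhang2022LandauSiegel, Prop 7.1 p.44, (7.2)] -/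
theorem vernierExactCellPSD_iff (θ : ℝ) (J : ℕ) (m : ℝ) :
    VernierExactCellPSD θ J m ↔
      Det.FormDetPSD (Det.shiftRecipe (vernierScaledShifts (exactConversionScale θ J) J m)) := Iff.rfl

/-- For `0 ≤ θ < J + ½` the exact conversion scale lies in `(0, 1]`, so the cell is an instance of the barrier-note
shape: `ConsistentVernierPSD J m → VernierExactCellPSD θ J m`. [cite: Zhang2022LandauSiegel, §2 (2.13)] -/
theorem vernierExactCellPSD_of_consistent {θ : ℝ} {J : ℕ} {m : ℝ} (hθ : 0 ≤ θ) (hθJ : θ < (J : ℝ) + 1 / 2)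
    (h : ConsistentVernierPSD J m) : VernierExactCellPSD θ J m := by
  have hJ : (0 : ℝ) < (J : ℝ) + 1 / 2 := by positivity
  refine h _ ?_ ?_
  · rw [exactConversionScale, sub_pos, div_lt_one hJ]; exact hθJ
  · rw [exactConversionScale, sub_le_self_iff]; exact div_nonneg hθ hJ.le

/-! ## Part G — the barrier reading in kernel form: IF the consistent-booking slot is PSD at the design's cell, THEN no
dictionary whose constant is a value of that form can close (the sign crux is unavailable), whatever the value table —
the formal shape of «K1 dead ⇒ NOT-A-ROUTE» for bookings that collapse to a scaled vernier triple. Pure unfolding; the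
premise `ConsistentVernierPSD J m` / `VernierScaledPSD c J m` stays OPEN (certified cell-wise only). -/

/-- **PSD slot ⇒ every one-sided value of the booked form is `≥ 0`:** if `VernierScaledPSD c J m` then
`0 ≤ Det.FormDet (vernierScaledRecipe c J m) G G′` for every one-sided kinked profile `G` (`G(1) = 0`).
[cite: Zhang2022LandauSiegel, Prop 7.1 p.44, (7.2)] -/
theorem formDet_nonneg_of_vernierScaledPSD {c : ℝ} {J : ℕ} {m : ℝ} (h : VernierScaledPSD c J m) {G G' : ℝ → ℂ}
    (hG : Repair.KinkedProfile G G') (hG1 : G 1 = 0) : 0 ≤ Det.FormDet (vernierScaledRecipe c J m) G G' :=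
  h G G' hG hG1

/-- **… hence no NEGATIVE dictionary constant drawn from that form:** a sign crux `Det.FormDet (vernierScaledRecipe c J m) G G′ < 0`
on a one-sided kinked profile contradicts `VernierScaledPSD c J m` — the booked main term cannot feed the endgame
(`theorem1_of_vernier…` needs `m < 0`). [cite: Zhang2022LandauSiegel, Prop 7.1 p.44, (7.2); §2 p. 6] -/
theorem not_neg_formDet_of_vernierScaledPSD {c : ℝ} {J : ℕ} {m : ℝ} (h : VernierScaledPSD c J m) {G G' : ℝ → ℂ}
    (hG : Repair.KinkedProfile G G') (hG1 : G 1 = 0) : ¬ Det.FormDet (vernierScaledRecipe c J m) G G' < 0 :=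
  not_lt.mpr (formDet_nonneg_of_vernierScaledPSD h hG hG1)

/-- **The barrier-note shape at work:** `ConsistentVernierPSD J m` forbids a negative one-sided value of the booked form at
EVERY consistent scaling `c ∈ (0,1]` — in particular at the exact conversion scale `1 − θ/(J+½)` (`0 ≤ θ < J+½`) and at the
typed detector's near coordinate. [cite: Zhang2022LandauSiegel, Prop 7.1 p.44, (7.2); §2 Lemma 2.3] -/
theorem no_sign_crux_of_consistentVernierPSD {J : ℕ} {m : ℝ} (h : ConsistentVernierPSD J m) {c : ℝ} (hc : 0 < c)
    (hc1 : c ≤ 1) {G G' : ℝ → ℂ} (hG : Repair.KinkedProfile G G') (hG1 : G 1 = 0) :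
    0 ≤ Det.FormDet (vernierScaledRecipe c J m) G G' :=
  formDet_nonneg_of_vernierScaledPSD (h c hc hc1) hG hG1

/-- Conversely, ONE negative one-sided value at a consistent scaling refutes the barrier-note shape at that cell (what a
certified negative corner cell, kernel-checked, would establish). [cite: Zhang2022LandauSiegel, Prop 7.1 p.44, (7.2)] -/
theorem not_consistentVernierPSD_of_neg {J : ℕ} {m c : ℝ} (hc : 0 < c) (hc1 : c ≤ 1) {G G' : ℝ → ℂ}
    (hG : Repair.KinkedProfile G G') (hG1 : G 1 = 0) (hneg : Det.FormDet (vernierScaledRecipe c J m) G G' < 0) :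
    ¬ ConsistentVernierPSD J m :=
  fun h => not_neg_formDet_of_vernierScaledPSD (h c hc hc1) hG hG1 hneg

end Literature.NumberTheory.LFunctions.Zhang2022.KnifeEdgeEll.Vernier

end
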